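import Summits.QuantumAdvantage.AdviceFreeQNC0.SurgeryMass
import Summits.QuantumAdvantage.AdviceFreeQNC0.FarDictator
import Summits.QuantumAdvantage.AdviceFreeQNC0.ApMaj3Lt
import HarnessLib

/-!
# Cell qa-qnc0 — the two law-of-`J` lemmas and the SHARP far-dictator rung (planner qa-qnc0-p1 g19,
ROUND-18 §4; `exp19/Sketch19.lean` §5)

`rareNoParticlePairAtDist : RareNoParticlePairAtDist`, `rareShiftClosedParticles : RareShiftClosedParticles`
(Sketch19 §5 targets) and hence **`farDictatorHalf3 : FarDictatorHalf3`** UNCONDITIONALLY (`farDictatorHalf3_of`,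
`FarDictator.lean`): for every `ε > 0`, all large `n` and every offset `2 ≤ h ≤ n − 2`, the far-dictator strategy
`z_j = t_j(x) ⊕ x_{j+h}` satisfies the ring relation on at most `(1/2 + ε)·2^{n−1}` odd patterns — the planner's
limit value `1/2` for the first ENTANGLED dense family, as a tree theorem.

Both lemmas are instances of the multiplicity-surgery engine `mass_le_of_surgery` (`SurgeryMass.lean`) with the
pair-window surgery at `p` (zero at `p`, prescribed bit at `p + h`, ones on the rest of `N[p] ∪ N[p+h]`):
it loses `≤ 6` zeros, is `≤ 2^6`-to-one, and a surgered vector remembers `p` up to `≤ 12` candidates (a created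
pair / a created non-closed particle must meet the window).  Hence both exceptional events have `≤ 98304/n · 2^{n−1}`
odd patterns.

WHAT THIS IS NOT: crux 22907 untouched (far dictators are one affine family); separation NOT moved.
-/

namespace Summit.QuantumAdvantage.AdviceFreeQNC0.Fib19

open Finset Literature.Computability.QuantumComplexity Literature.Computability.QuantumComplexity.RingHLF
open Fin.CommRing

variable {n : ℕ}

section PairSurgery

/-- The pattern of the pair-window surgery: `0` at `p`, `b` elsewhere (read at `p + H`). -/
def pairPattern (b : Bool) (p : Fin n) : Fin n → Bool := fun i => if i = p then false else b

/-- The pair-window surgery at `p`: the pattern on `S = {p, p+H}`, ones on the rest of `nbhd S`, `v` elsewhere. -/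
def pairSurgery (H : Fin n) (b : Bool) (p : Fin n) (v : Fin n → Bool) : Fin n → Bool :=
  surgery (nbhd ({p, p + H} : Finset (Fin n)))
    (fun i => if i ∈ ({p, p + H} : Finset (Fin n)) then pairPattern b p i else true) v

/-- The surgered vector is hard-core with a zero (at `p`). -/
theorem pairSurgery_hardCore [NeZero n] (hn : 2 ≤ n) (H : Fin n) (hH1 : H ≠ 1) (hH2 : H + 1 ≠ 0) (b : Bool)
    (p : Fin n) (v : Fin n → Bool)
    (hv : ∀ i : Fin n, ¬ (v i = false ∧ v (nxt i) = false)) :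
    HardCore (pairSurgery H b p v) ∧ 0 < zeros (pairSurgery H b p v) := by
  have hnp : nxt p = p + 1 := nxt_eq_add_one p
  have hnq : nxt (p + H) = p + H + 1 := nxt_eq_add_one (p + H)
  have h10 : (1 : Fin n) ≠ 0 := by
    intro e
    have := congrArg Fin.val e
    rw [Fin.val_one', Fin.val_zero, Nat.mod_eq_of_lt (by omega)] at this
    omega
  constructor
  · refine hardCore_surgery_of_one {p, p + H} (pairPattern b p) ?_ v hv (i₀ := nxt p)
      (nxt_mem_nbhd (by simp)) ?_
    · intro i hi hni
      simp only [mem_insert, mem_singleton] at hi hni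
      rcases hi with rfl | rfl
      · rcases hni with e | e
        · rw [hnp] at e; exact absurd (by linear_combination e) h10
        · rw [hnp] at e; exact absurd (by linear_combination -e) hH1
      · rcases hni with e | e
        · rw [hnq] at e; exact absurd (by linear_combination e) hH2
        · rw [hnq] at e; exact absurd (by linear_combination e) h10
    · have hne1 : p + 1 ≠ p := fun e => h10 (by linear_combination e)
      have hne2 : p + 1 ≠ p + H := fun e => hH1 (by linear_combination -e)
      simp [hnp, hne1, hne2]
  · refine card_pos.2 ⟨p, mem_filter.2 ⟨mem_univ _, ?_⟩⟩
    unfold pairSurgery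
    rw [surgery_of_mem (subset_nbhd _ (by simp))]
    simp [pairPattern]

/-- The surgery loses at most `6` zeros. -/
theorem zeros_le_pairSurgery (H : Fin n) (b : Bool) (p : Fin n) (v : Fin n → Bool) :
    zeros v ≤ zeros (pairSurgery H b p v) + 6 := by
  have h := zeros_le_zeros_surgery_add (nbhd ({p, p + H} : Finset (Fin n)))
    (fun i => if i ∈ ({p, p + H} : Finset (Fin n)) then pairPattern b p i else true) v
  have hW : (nbhd ({p, p + H} : Finset (Fin n))).card ≤ 6 :=
    (card_nbhd_le _).trans (by linarith [card_le_two (a := p) (b := p + H)])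
  unfold pairSurgery
  omega

/-- The surgery is at most `2^6`-to-one on any set. -/
theorem card_fibre_pairSurgery_le (H : Fin n) (b : Bool) (p : Fin n) (A : Finset (Fin n → Bool))
    (v' : Fin n → Bool) :
    (A.filter fun v => pairSurgery H b p v = v').card ≤ 64 := by
  have hW : (nbhd ({p, p + H} : Finset (Fin n))).card ≤ 6 :=
    (card_nbhd_le _).trans (by linarith [card_le_two (a := p) (b := p + H)])
  refine (card_le_two_pow_of_eq_off (nbhd ({p, p + H} : Finset (Fin n))) v' _ fun u hu i hi => ?_).trans
    ((Nat.pow_le_pow_right two_pos hW).trans (by norm_num))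
  rw [mem_filter] at hu
  rw [← hu.2]
  unfold pairSurgery
  rw [surgery_of_not_mem hi]

/-- Values of the surgered vector at `p` and `p + H`. -/
theorem pairSurgery_apply [NeZero n] (H : Fin n) (hH0 : H ≠ 0) (b : Bool) (p : Fin n) (v : Fin n → Bool) :
    pairSurgery H b p v p = false ∧ pairSurgery H b p v (p + H) = b := by
  have hne : p + H ≠ p := fun e => hH0 (by linear_combination e)
  unfold pairSurgery
  rw [surgery_of_mem (subset_nbhd _ (by simp)), surgery_of_mem (subset_nbhd _ (by simp))]
  simp [pairPattern, hne]

/-- Off the window the surgered vector is the old one. -/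
theorem pairSurgery_apply_of_not_mem (H : Fin n) (b : Bool) (p : Fin n) (v : Fin n → Bool) {i : Fin n}
    (hi : i ∉ nbhd ({p, p + H} : Finset (Fin n))) : pairSurgery H b p v i = v i := by
  unfold pairSurgery
  rw [surgery_of_not_mem hi]

/-- A position `p` whose pair `(p, p+H)` avoids a window of `≤ 6` points lies among `≤ 12` candidates. -/
theorem card_meet_window_le [NeZero n] (H : Fin n) (W : Finset (Fin n)) (hW : W.card ≤ 6) :
    (univ.filter fun p : Fin n => p ∈ W ∨ p + H ∈ W).card ≤ 12 := by
  calc (univ.filter fun p : Fin n => p ∈ W ∨ p + H ∈ W).card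
      ≤ (W ∪ W.image fun q => q - H).card := by
        refine card_le_card fun p hp => ?_
        rw [mem_filter] at hp
        rw [mem_union, mem_image]
        rcases hp.2 with h | h
        · exact Or.inl h
        · exact Or.inr ⟨p + H, h, add_sub_cancel_right p H⟩
    _ ≤ W.card + (W.image fun q => q - H).card := card_union_le _ _
    _ ≤ 6 + 6 := add_le_add hW (card_image_le.trans hW)

end PairSurgery

/-! ### The generic density bound for the two events -/

/-- The common counting step: an event `A` of hard-core vectors, stable in the sense that the pair surgery (bit `b` at
`p + H`) maps it to vectors whose "witness positions" meet the window, has `n·#{x odd : J x ∈ A} ≤ 98304·2^{n-1}`. -/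
theorem mass_pairSurgery_le [NeZero n] (hn : 3 ≤ n) (H : Fin n) (hH1 : H ≠ 1) (hH2 : H + 1 ≠ 0)
    (b : Bool) (A : Finset (Fin n → Bool)) (hA : ∀ v ∈ A, HardCore v)
    (hwit : ∀ v₀ ∈ A, ∀ p₀ p : Fin n, (∃ v ∈ A, pairSurgery H b p v = pairSurgery H b p₀ v₀) →
      p ∈ nbhd ({p₀, p₀ + H} : Finset (Fin n)) ∨ p + H ∈ nbhd ({p₀, p₀ + H} : Finset (Fin n))) :
    n * (univ.filter fun x : Fin n → Bool => IsOdd x ∧ kline x ∈ A).card ≤ 98304 * 2 ^ (n - 1) := by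
  have h := mass_le_of_surgery hn A (pairSurgery H b) 6 64 12
    (fun p v hv => pairSurgery_hardCore (by omega) H hH1 hH2 b p v (hA v hv).1)
    (fun p v _ => zeros_le_pairSurgery H b p v)
    (fun p v' => card_fibre_pairSurgery_le H b p A v')
    (fun v' => ?_)
  · simpa using h
  · -- the multiplicity: realised positions meet the window of any realised position
    by_cases hne : (univ.filter fun p : Fin n => ∃ v ∈ A, pairSurgery H b p v = v').Nonempty
    · obtain ⟨p₀, hp₀⟩ := hne
      rw [mem_filter] at hp₀
      obtain ⟨v₀, hv₀, hv'⟩ := hp₀.2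
      have hW : (nbhd ({p₀, p₀ + H} : Finset (Fin n))).card ≤ 6 :=
        (card_nbhd_le _).trans (by linarith [card_le_two (a := p₀) (b := p₀ + H)])
      refine le_trans (card_le_card fun p hp => ?_) (card_meet_window_le H _ hW)
      rw [mem_filter] at hp ⊢
      refine ⟨mem_univ _, hwit v₀ hv₀ p₀ p ?_⟩
      rw [hv']; exact hp.2
    · rw [not_nonempty_iff_eq_empty.1 hne, card_empty]; omega

/-- From `n · E ≤ 98304 · 2^{n-1}` to `E ≤ ε · 2^{n-1}` for `n ≥ 98304/ε`. -/
theorem density_le_of_mass_le {E : ℕ} {ε : ℝ} (hε : 0 < ε) (hn : ⌈(98304 : ℝ) / ε⌉₊ ≤ n) (hn0 : 0 < n)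
    (h : n * E ≤ 98304 * 2 ^ (n - 1)) : (E : ℝ) ≤ ε * (2 : ℝ) ^ (n - 1) := by
  have h1 : (98304 : ℝ) / ε ≤ n := le_trans (Nat.le_ceil _) (by exact_mod_cast hn)
  have h2 : (98304 : ℝ) ≤ ε * n := by rwa [div_le_iff₀ hε, mul_comm] at h1
  have h3 : ((n * E : ℕ) : ℝ) ≤ ((98304 * 2 ^ (n - 1) : ℕ) : ℝ) := by exact_mod_cast h
  push_cast at h3
  have hn' : (0 : ℝ) < n := by exact_mod_cast hn0
  have hp : (0 : ℝ) ≤ (2 : ℝ) ^ (n - 1) := by positivity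
  nlinarith

/-! ### Law-of-`J` lemma (i): two particles at distance `h` -/

/-- **`RareNoParticlePairAtDist` — PROVED.** -/
theorem rareNoParticlePairAtDist : RareNoParticlePairAtDist := by
  classical
  intro ε hε
  refine ⟨max 4 ⌈(98304 : ℝ) / ε⌉₊, fun n hn h hh hhn => ?_⟩
  have hn4 : 4 ≤ n := le_trans (le_max_left _ _) hn
  haveI : NeZero n := ⟨by omega⟩
  set H : Fin n := (h : Fin n) with hHdef
  have hH0 : H ≠ 0 := natCast_ne_zero_of_lt (by omega) (by omega)
  have hH1 : H ≠ 1 := by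
    intro e
    have := congrArg Fin.val e
    rw [hHdef, Fin.val_natCast, Fin.val_one', Nat.mod_eq_of_lt (by omega : h < n),
      Nat.mod_eq_of_lt (by omega : 1 < n)] at this
    omega
  have hH2 : H + 1 ≠ 0 := by
    rw [hHdef, ← Nat.cast_one, ← Nat.cast_add]
    exact natCast_ne_zero_of_lt (by omega) (by omega)
  set A : Finset (Fin n → Bool) := univ.filter fun v : Fin n → Bool =>
    HardCore v ∧ ∀ q : Fin n, ¬ (v q = false ∧ v (q + H) = false) with hAdef
  have hA : ∀ v ∈ A, HardCore v := fun v hv => ((mem_filter.1 hv).2).1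
  have hmass := mass_pairSurgery_le (by omega) H hH1 hH2 false A hA (by
    intro v₀ hv₀ p₀ p ⟨v, hv, hvv⟩
    by_contra hnot
    push Not at hnot
    obtain ⟨h1, h2⟩ := hnot
    have hvp := (pairSurgery_apply H hH0 false p v).1
    have hvq := (pairSurgery_apply H hH0 false p v).2
    rw [hvv, pairSurgery_apply_of_not_mem H false p₀ v₀ h1] at hvp
    rw [hvv, pairSurgery_apply_of_not_mem H false p₀ v₀ h2] at hvq
    exact ((mem_filter.1 hv₀).2).2 p ⟨hvp, hvq⟩)
  have hsub : (univ.filter fun x : Fin n → Bool => OddZeros x ∧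
      ∀ p : Fin n, ¬ (kline x p = false ∧ kline x (shift h p) = false)).card ≤
      (univ.filter fun x : Fin n → Bool => IsOdd x ∧ kline x ∈ A).card := by
    refine card_le_card fun x hx => ?_
    simp only [mem_filter, mem_univ, true_and] at hx
    have ho := (isOdd_iff_oddZeros x).2 hx.1
    rw [mem_filter, hAdef, mem_filter]
    refine ⟨mem_univ _, ho, mem_univ _, kline_hardCore (by omega) x ho, fun q => ?_⟩
    rw [← shift_eq_add]; exact hx.2 q
  exact le_trans (by exact_mod_cast hsub)
    (density_le_of_mass_le hε (le_trans (le_max_right _ _) hn) (by omega) hmass)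

/-! ### Law-of-`J` lemma (ii): the particle set is not shift-closed -/

/-- **`RareShiftClosedParticles` — PROVED.** -/
theorem rareShiftClosedParticles : RareShiftClosedParticles := by
  classical
  intro ε hε
  refine ⟨max 4 ⌈(98304 : ℝ) / ε⌉₊, fun n hn h hh hhn => ?_⟩
  have hn4 : 4 ≤ n := le_trans (le_max_left _ _) hn
  haveI : NeZero n := ⟨by omega⟩
  set H : Fin n := (h : Fin n) with hHdef
  have hH0 : H ≠ 0 := natCast_ne_zero_of_lt (by omega) (by omega)
  have hH1 : H ≠ 1 := by
    intro e
    have := congrArg Fin.val e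
    rw [hHdef, Fin.val_natCast, Fin.val_one', Nat.mod_eq_of_lt (by omega : h < n),
      Nat.mod_eq_of_lt (by omega : 1 < n)] at this
    omega
  have hH2 : H + 1 ≠ 0 := by
    rw [hHdef, ← Nat.cast_one, ← Nat.cast_add]
    exact natCast_ne_zero_of_lt (by omega) (by omega)
  set A : Finset (Fin n → Bool) := univ.filter fun v : Fin n → Bool =>
    HardCore v ∧ ∀ q : Fin n, v q = false → v (q + H) = false with hAdef
  have hA : ∀ v ∈ A, HardCore v := fun v hv => ((mem_filter.1 hv).2).1
  have hmass := mass_pairSurgery_le (by omega) H hH1 hH2 true A hA (by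
    intro v₀ hv₀ p₀ p ⟨v, hv, hvv⟩
    by_contra hnot
    push Not at hnot
    obtain ⟨h1, h2⟩ := hnot
    have hvp := (pairSurgery_apply H hH0 true p v).1
    have hvq := (pairSurgery_apply H hH0 true p v).2
    rw [hvv, pairSurgery_apply_of_not_mem H true p₀ v₀ h1] at hvp
    rw [hvv, pairSurgery_apply_of_not_mem H true p₀ v₀ h2] at hvq
    have := ((mem_filter.1 hv₀).2).2 p hvp
    rw [hvq] at this
    exact Bool.noConfusion this)
  have hsub : (univ.filter fun x : Fin n → Bool => OddZeros x ∧
      ∀ p : Fin n, kline x p = false → kline x (shift h p) = false).card ≤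
      (univ.filter fun x : Fin n → Bool => IsOdd x ∧ kline x ∈ A).card := by
    refine card_le_card fun x hx => ?_
    simp only [mem_filter, mem_univ, true_and] at hx
    have ho := (isOdd_iff_oddZeros x).2 hx.1
    rw [mem_filter, hAdef, mem_filter]
    refine ⟨mem_univ _, ho, mem_univ _, kline_hardCore (by omega) x ho, fun q hq => ?_⟩
    rw [← shift_eq_add]; exact hx.2 q hq
  exact le_trans (by exact_mod_cast hsub)
    (density_le_of_mass_le hε (le_trans (le_max_right _ _) hn) (by omega) hmass)

/-! ### The sharp rung -/

/-- **RUNG `FarDictatorHalf3` — PROVED unconditionally**: far dictators satisfy the ring relation on at most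
`(1/2 + ε)·2^{n−1}` odd patterns (planner's limit value `1/2`). -/
theorem farDictatorHalf3 : FarDictatorHalf3 :=
  farDictatorHalf3_of rareNoParticlePairAtDist rareShiftClosedParticles

end Summit.QuantumAdvantage.AdviceFreeQNC0.Fib19
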